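import Mathlib
import Literature.Probability.Percolation.PercolationProofs
import Literature.Probability.LatticeModels.ProdBernoulliIndependence
import Literature.Probability.LatticeModels.ProdBernoulliClusterLocality
import Literature.Probability.Percolation.ConditionalPositiveAssociation
import Literature.Probability.Percolation.ConditionalPositiveAssociationProofs
import Literature.Probability.Percolation.TwoClusterConditionalAssociation
import Literature.Probability.Percolation.TwoClusterConditionalAssociationProofs
import Summits.CriticalPhenomena.PercolationContinuityZ3.Theorems.PercNearOneGluingNearOneGluingKnLemma3i
import HarnessLib

/-! # Crux `PercNearOneGluing.AdditiveGluing` (stmt-CriticalPhenomena-4576), line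
`sigma-recursion-lemma5-any-relay` — stub `stub_knThm1Set`

Helper file for the crux skeleton
`Cruxes/AdditiveGluing/Lines/sigma-recursion-lemma5-any-relay.lean` (lead
prover-line-stmt-CriticalPhenomena-4576-0).  Proves exactly the registered stub signature
`stub_knThm1Set`; lands with `--supports stmt-CriticalPhenomena-4576`.

## Content

Kozma–Nitzan, arXiv:2401.12397, **Theorem 1** (§3.1, pp. 7–8): the pre-FKG inequality (3) for
TWO relays `a₁, a₂`, here for an observer SET `S` on the finite weighted graph `Fin n`
(`μ = prodBernoulli w` on `BondConfig (Fin n) = Set (Sym2 (Fin n))`).  With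
`{S ↔ x} := ⋃_{s ∈ S} {s ↔ x}` and `E := ⋃_{s ∈ S} ({s ↔ a₁} ∪ {s ↔ a₂}) = {S ↔ a₁} ∪ {S ↔ a₂}`:
`min (μ(E ∩ {a₁ ↔ b}), μ(E ∩ {a₂ ↔ b})) ≤ μ(E ∩ {S ↔ b})`.

Proof (KN pp. 7–8 with `0 ↦ S`).  Put `D := {a₁ ↮ a₂} = (openConn a₁ a₂)ᶜ` and the
denominator-free coefficients `φᵢ := μ(D ∩ {S ↔ aᵢ})`.
* STEP 1 (event algebra, `knThm1Set_step1`): pointwise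
  `D ∩ {a₂ ↔ b} ∩ {S ↔ a₂} ⊆ (E ∩ {S ↔ b}) ∖ {a₁ ↔ b}` and
  `(E ∩ {a₁ ↔ b}) ∖ {S ↔ b} ⊆ D ∩ {a₁ ↔ b} ∩ {S ↔ a₂}`, whence
  `μ(E ∩ {S ↔ b}) − μ(E ∩ {a₁ ↔ b}) ≥ X₂ − Y₂` with `X₂ := μ(D ∩ {a₂ ↔ b} ∩ {S ↔ a₂})`,
  `Y₂ := μ(D ∩ {a₁ ↔ b} ∩ {S ↔ a₂})`; symmetrically with `1 ↔ 2`.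
* STEP 2 (BHK, `knThm1Set_bhk`): the events `{S ↔ aᵢ}` are increasing and determined by the
  open edge cluster of `aᵢ` (`knThm1Set_upClosed`), so the two proved BHK shapes of the sibling
  file `…NearOneGluingKnLemma3i` apply: van den Berg–Häggström–Kahn 2006 Thm. 1.3
  (`knLemma3i_oneCluster`) gives `P₂ φ₂ ≤ m X₂`, `P₁ φ₁ ≤ m X₁`, and Thm. 1.4
  (`knLemma3i_twoCluster`) gives `m Y₂ ≤ P₁ φ₂`, `m Y₁ ≤ P₂ φ₁` (`m := μ(D)`,
  `Pᵢ := μ(D ∩ {aᵢ ↔ b})`).  The products cancel: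
  `m · [φ₁ (X₂ − Y₂) + φ₂ (X₁ − Y₁)] ≥ φ₁φ₂ (P₂ − P₁ + P₁ − P₂) = 0` (`knThm1Set_arith`).
* Assembly (`Tᵢ := μ(E ∩ {aᵢ ↔ b})`, `R := μ(E ∩ {S ↔ b})`): `φ₁ T₁ + φ₂ T₂ ≤ (φ₁ + φ₂) R`
  (STEP 1 times `φᵢ`, plus STEP 2), so `min(T₁, T₂) ≤ R` if `φ₁ + φ₂ > 0`; if
  `φ₁ = φ₂ = 0` then `E ∩ D` is null and on `{a₁ ↔ a₂}` one has `E ∩ {a₁ ↔ b} ⊆ E ∩ {S ↔ b}`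
  pointwise (`knThm1Set_degenerate`; this also covers `a₁ = a₂`, where `D = ∅`).
-/

namespace Summit.CriticalPhenomena.PercolationContinuityZ3.Theorems

open MeasureTheory Set
open Literature.Probability.LatticeModels (prodBernoulli)
open Literature.Probability.Percolation (BondConfig openConn openGraph openEdgeCluster)

noncomputable section
open Classical

variable {n : ℕ}

/-- The event `{S ↔ a} = ⋃_{s ∈ S} {s ↔ a}` is increasing and determined by the open edge
cluster `C_a` of `a`: `ω ∈ {S ↔ a}` and `C_a(ω) ⊆ C_a(ω')` imply `ω' ∈ {S ↔ a}`.
[cite: VandenbergHaggstromKahn2005, §1 p. 3 ("A simple example of such an event is {s ↔ a}")] -/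
theorem knThm1Set_upClosed (S : Finset (Fin n)) (a : Fin n) :
    ∀ ω ω' : BondConfig (Fin n), ω ∈ (⋃ s ∈ S, openConn s a : Set (BondConfig (Fin n))) →
      openEdgeCluster ω a ⊆ openEdgeCluster ω' a →
      ω' ∈ (⋃ s ∈ S, openConn s a : Set (BondConfig (Fin n))) := by
  intro ω ω' hω hsub
  simp only [Set.mem_iUnion, exists_prop] at hω ⊢
  obtain ⟨s, hs, hωs⟩ := hω
  refine ⟨s, hs, ?_⟩
  have h : (openGraph ω).Reachable a s := SimpleGraph.Reachable.symm hωs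
  rw [Literature.Probability.Percolation.reachable_iff_exists_mem_openEdgeCluster] at h
  have h' : (openGraph ω').Reachable a s := by
    rw [Literature.Probability.Percolation.reachable_iff_exists_mem_openEdgeCluster]
    exact h.imp id fun ⟨e, he, hse⟩ => ⟨e, hsub he, hse⟩
  exact h'.symm

/-- **STEP 1 of KN Theorem 1 (event algebra).**  For `{S ↔ a₂} ⊆ E ⊆ {S ↔ a₁} ∪ {S ↔ a₂}` and
`D = {a₁ ↮ a₂}`:
`μ(D ∩ {a₂ ↔ b} ∩ {S ↔ a₂}) − μ(D ∩ {a₁ ↔ b} ∩ {S ↔ a₂}) ≤ μ(E ∩ {S ↔ b}) − μ(E ∩ {a₁ ↔ b})`,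
from the pointwise inclusions `D ∩ {a₂ ↔ b} ∩ {S ↔ a₂} ⊆ (E ∩ {S ↔ b}) ∖ {a₁ ↔ b}` and
`(E ∩ {a₁ ↔ b}) ∖ {S ↔ b} ⊆ D ∩ {a₁ ↔ b} ∩ {S ↔ a₂}`.
[cite: KozmaNitzan2024, Theorem 1, proof (pp. 7–8, the two displays after (3))] -/
theorem knThm1Set_step1 (w : Sym2 (Fin n) → unitInterval) (S : Finset (Fin n))
    (a₁ a₂ b : Fin n) (E : Set (BondConfig (Fin n)))
    (hE₂ : (⋃ s ∈ S, openConn s a₂ : Set (BondConfig (Fin n))) ⊆ E)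
    (hE : E ⊆ (⋃ s ∈ S, openConn s a₁ : Set (BondConfig (Fin n))) ∪ ⋃ s ∈ S, openConn s a₂) :
    (prodBernoulli w).real ((openConn a₁ a₂)ᶜ ∩ (openConn a₂ b ∩ ⋃ s ∈ S, openConn s a₂)) -
        (prodBernoulli w).real
          ((openConn a₁ a₂)ᶜ ∩ (openConn a₁ b ∩ ⋃ s ∈ S, openConn s a₂)) ≤
      (prodBernoulli w).real (E ∩ ⋃ s ∈ S, openConn s b) -
        (prodBernoulli w).real (E ∩ openConn a₁ b) := by
  have hm1 : MeasurableSet (openConn a₁ b : Set (BondConfig (Fin n))) :=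
    MeasurableSet.of_discrete
  have hmS : MeasurableSet (⋃ s ∈ S, openConn s b : Set (BondConfig (Fin n))) :=
    MeasurableSet.of_discrete
  have h1 := measureReal_inter_add_sdiff (μ := prodBernoulli w)
    (s := E ∩ ⋃ s ∈ S, openConn s b) hm1
  have h2 := measureReal_inter_add_sdiff (μ := prodBernoulli w) (s := E ∩ openConn a₁ b) hmS
  have h3 : (E ∩ ⋃ s ∈ S, openConn s b) ∩ openConn a₁ b =
      (E ∩ openConn a₁ b) ∩ ⋃ s ∈ S, openConn s b :=
    Set.inter_right_comm _ _ _
  -- `D ∩ {a₂ ↔ b} ∩ {S ↔ a₂} ⊆ (E ∩ {S ↔ b}) ∖ {a₁ ↔ b}`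
  have h4 : (openConn a₁ a₂)ᶜ ∩ (openConn a₂ b ∩ ⋃ s ∈ S, openConn s a₂) ⊆
      (E ∩ ⋃ s ∈ S, openConn s b) \ openConn a₁ b := by
    rintro ω ⟨hD, h2b, hS2⟩
    have hS2' := hS2
    simp only [Set.mem_iUnion, exists_prop] at hS2'
    obtain ⟨s, hs, hs2⟩ := hS2'
    refine ⟨⟨hE₂ hS2, ?_⟩, ?_⟩
    · simp only [Set.mem_iUnion, exists_prop]
      exact ⟨s, hs, SimpleGraph.Reachable.trans hs2 h2b⟩
    · intro h1b
      exact hD (SimpleGraph.Reachable.trans h1b (SimpleGraph.Reachable.symm h2b))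
  -- `(E ∩ {a₁ ↔ b}) ∖ {S ↔ b} ⊆ D ∩ {a₁ ↔ b} ∩ {S ↔ a₂}`
  have h5 : (E ∩ openConn a₁ b) \ (⋃ s ∈ S, openConn s b) ⊆
      (openConn a₁ a₂)ᶜ ∩ (openConn a₁ b ∩ ⋃ s ∈ S, openConn s a₂) := by
    rintro ω ⟨⟨hωE, h1b⟩, hSb⟩
    simp only [Set.mem_iUnion, exists_prop, not_exists, not_and] at hSb
    have hωE' := hE hωE
    simp only [Set.mem_union, Set.mem_iUnion, exists_prop] at hωE'
    have hS2 : ∃ s ∈ S, ω ∈ (openConn s a₂ : Set (BondConfig (Fin n))) := by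
      rcases hωE' with ⟨s, hs, hs1⟩ | ⟨s, hs, hs2⟩
      · exact absurd (SimpleGraph.Reachable.trans hs1 h1b) (hSb s hs)
      · exact ⟨s, hs, hs2⟩
    obtain ⟨s, hs, hs2⟩ := hS2
    refine ⟨?_, h1b, ?_⟩
    · intro h12
      exact hSb s hs (SimpleGraph.Reachable.trans
        (SimpleGraph.Reachable.trans hs2 (SimpleGraph.Reachable.symm h12)) h1b)
    · simp only [Set.mem_iUnion, exists_prop]
      exact ⟨s, hs, hs2⟩
  have h4' := measureReal_mono (μ := prodBernoulli w) h4
  have h5' := measureReal_mono (μ := prodBernoulli w) h5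
  rw [h3] at h1
  linarith

/-- **Degenerate case of KN Theorem 1.**  If `E ⊆ {S ↔ a₁} ∪ {S ↔ a₂}` and both
`μ(D ∩ {S ↔ aᵢ}) = 0` (`D = {a₁ ↮ a₂}`), then `μ(E ∩ {a₁ ↔ b}) ≤ μ(E ∩ {S ↔ b})`: the part of
`E ∩ {a₁ ↔ b}` on `D` is null, and on `{a₁ ↔ a₂}` it lies in `E ∩ {S ↔ b}` pointwise
(`s ↔ aⱼ ↔ a₁ ↔ b`). [cite: KozmaNitzan2024, Theorem 1, proof (p. 8)] -/
theorem knThm1Set_degenerate (w : Sym2 (Fin n) → unitInterval) (S : Finset (Fin n))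
    (a₁ a₂ b : Fin n) (E : Set (BondConfig (Fin n)))
    (hE : E ⊆ (⋃ s ∈ S, openConn s a₁ : Set (BondConfig (Fin n))) ∪ ⋃ s ∈ S, openConn s a₂)
    (h₁ : (prodBernoulli w).real ((openConn a₁ a₂)ᶜ ∩ ⋃ s ∈ S, openConn s a₁) = 0)
    (h₂ : (prodBernoulli w).real ((openConn a₁ a₂)ᶜ ∩ ⋃ s ∈ S, openConn s a₂) = 0) :
    (prodBernoulli w).real (E ∩ openConn a₁ b) ≤
      (prodBernoulli w).real (E ∩ ⋃ s ∈ S, openConn s b) := by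
  have hm : MeasurableSet (openConn a₁ a₂ : Set (BondConfig (Fin n))) :=
    MeasurableSet.of_discrete
  have h1 := measureReal_inter_add_sdiff (μ := prodBernoulli w) (s := E ∩ openConn a₁ b) hm
  -- on `{a₁ ↔ a₂}` the event lies in `E ∩ {S ↔ b}`
  have hin : (E ∩ openConn a₁ b) ∩ openConn a₁ a₂ ⊆ E ∩ ⋃ s ∈ S, openConn s b := by
    rintro ω ⟨⟨hωE, h1b⟩, h12⟩
    refine ⟨hωE, ?_⟩
    have hωE' := hE hωE
    simp only [Set.mem_union, Set.mem_iUnion, exists_prop] at hωE'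
    simp only [Set.mem_iUnion, exists_prop]
    rcases hωE' with ⟨s, hs, hs1⟩ | ⟨s, hs, hs2⟩
    · exact ⟨s, hs, SimpleGraph.Reachable.trans hs1 h1b⟩
    · exact ⟨s, hs, SimpleGraph.Reachable.trans
        (SimpleGraph.Reachable.trans hs2 (SimpleGraph.Reachable.symm h12)) h1b⟩
  -- the part on `D` is null
  have hout : (E ∩ openConn a₁ b) \ openConn a₁ a₂ ⊆
      ((openConn a₁ a₂)ᶜ ∩ ⋃ s ∈ S, openConn s a₁) ∪
        ((openConn a₁ a₂)ᶜ ∩ ⋃ s ∈ S, openConn s a₂) := by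
    rintro ω ⟨⟨hωE, -⟩, h12⟩
    rcases hE hωE with h | h
    · exact Or.inl ⟨h12, h⟩
    · exact Or.inr ⟨h12, h⟩
  have hnull : (prodBernoulli w).real ((E ∩ openConn a₁ b) \ openConn a₁ a₂) = 0 := by
    refine measureReal_mono_null hout (le_antisymm ?_ measureReal_nonneg)
    calc (prodBernoulli w).real (((openConn a₁ a₂)ᶜ ∩ ⋃ s ∈ S, openConn s a₁) ∪
            ((openConn a₁ a₂)ᶜ ∩ ⋃ s ∈ S, openConn s a₂))
        ≤ (prodBernoulli w).real ((openConn a₁ a₂)ᶜ ∩ ⋃ s ∈ S, openConn s a₁) +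
            (prodBernoulli w).real ((openConn a₁ a₂)ᶜ ∩ ⋃ s ∈ S, openConn s a₂) :=
          measureReal_union_le _ _
      _ = 0 := by rw [h₁, h₂, add_zero]
  have hin' := measureReal_mono (μ := prodBernoulli w) hin
  linarith

/-- Real-arithmetic core of STEP 2: the four BHK bounds `P₂ φ₂ ≤ m X₂`, `m Y₂ ≤ P₁ φ₂`,
`P₁ φ₁ ≤ m X₁`, `m Y₁ ≤ P₂ φ₁` give `0 ≤ φ₁ (X₂ − Y₂) + φ₂ (X₁ − Y₁)` (multiply by `m`; the
products `φ₁ φ₂ Pᵢ` cancel; if `m = 0` use `Yᵢ ≤ m`, `0 ≤ Xᵢ`). [folklore] -/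
theorem knThm1Set_arith {m φ₁ φ₂ P₁ P₂ X₁ X₂ Y₁ Y₂ : ℝ}
    (hm : 0 ≤ m) (hφ₁ : 0 ≤ φ₁) (hφ₂ : 0 ≤ φ₂) (hX₁ : 0 ≤ X₁) (hX₂ : 0 ≤ X₂)
    (hY₁ : Y₁ ≤ m) (hY₂ : Y₂ ≤ m)
    (hi : P₂ * φ₂ ≤ m * X₂) (hii : m * Y₂ ≤ P₁ * φ₂)
    (hiii : P₁ * φ₁ ≤ m * X₁) (hiv : m * Y₁ ≤ P₂ * φ₁) :
    0 ≤ φ₁ * (X₂ - Y₂) + φ₂ * (X₁ - Y₁) := by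
  rcases eq_or_lt_of_le hm with hm0 | hmpos
  · have hA : 0 ≤ X₂ - Y₂ := by linarith
    have hB : 0 ≤ X₁ - Y₁ := by linarith
    exact add_nonneg (mul_nonneg hφ₁ hA) (mul_nonneg hφ₂ hB)
  · refine le_of_mul_le_mul_left ?_ hmpos
    have h1 := mul_le_mul_of_nonneg_left hi hφ₁
    have h2 := mul_le_mul_of_nonneg_left hii hφ₁
    have h3 := mul_le_mul_of_nonneg_left hiii hφ₂
    have h4 := mul_le_mul_of_nonneg_left hiv hφ₂
    rw [mul_zero]
    linarith [h1, h2, h3, h4]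

/-- **STEP 2 of KN Theorem 1 (four applications of BHK 2006).**  For `a₁ ≠ a₂`,
`D = {a₁ ↮ a₂}`, `φᵢ = μ(D ∩ {S ↔ aᵢ})`:
`0 ≤ φ₁ [μ(D, a₂↔b, S↔a₂) − μ(D, a₁↔b, S↔a₂)] + φ₂ [μ(D, a₁↔b, S↔a₁) − μ(D, a₂↔b, S↔a₁)]`,
by van den Berg–Häggström–Kahn Thm. 1.3 (`knLemma3i_oneCluster`, `s = aᵢ`, `X = {aⱼ}`,
`Q = {S ↔ aᵢ}`) and Thm. 1.4 (`knLemma3i_twoCluster`, `s = aⱼ`, `t = aᵢ`, `Q = {S ↔ aᵢ}`).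
[cite: KozmaNitzan2024, Theorem 1, proof (p. 8, "m·L ≥ 0")] -/
theorem knThm1Set_bhk (w : Sym2 (Fin n) → unitInterval) (S : Finset (Fin n)) (a₁ a₂ b : Fin n)
    (h12 : a₁ ≠ a₂) :
    0 ≤ (prodBernoulli w).real ((openConn a₁ a₂)ᶜ ∩ ⋃ s ∈ S, openConn s a₁) *
          ((prodBernoulli w).real
              ((openConn a₁ a₂)ᶜ ∩ (openConn a₂ b ∩ ⋃ s ∈ S, openConn s a₂)) -
            (prodBernoulli w).real
              ((openConn a₁ a₂)ᶜ ∩ (openConn a₁ b ∩ ⋃ s ∈ S, openConn s a₂))) +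
        (prodBernoulli w).real ((openConn a₁ a₂)ᶜ ∩ ⋃ s ∈ S, openConn s a₂) *
          ((prodBernoulli w).real
              ((openConn a₁ a₂)ᶜ ∩ (openConn a₁ b ∩ ⋃ s ∈ S, openConn s a₁)) -
            (prodBernoulli w).real
              ((openConn a₁ a₂)ᶜ ∩ (openConn a₂ b ∩ ⋃ s ∈ S, openConn s a₁))) := by
  have hQ₁ := knThm1Set_upClosed S a₁
  have hQ₂ := knThm1Set_upClosed S a₂
  have hcomm : (openConn a₂ a₁ : Set (BondConfig (Fin n))) = openConn a₁ a₂ :=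
    Set.ext fun _ => ⟨fun h => SimpleGraph.Reachable.symm h, fun h => SimpleGraph.Reachable.symm h⟩
  -- (i) BHK Thm. 1.3: `s = a₂`, `X = {a₁}`, `Q = {S ↔ a₂}`
  have hi := knLemma3i_oneCluster w a₂ a₁ b (⋃ s ∈ S, openConn s a₂) hQ₂ h12.symm
  rw [hcomm] at hi
  -- (ii) BHK Thm. 1.4: `s = a₁`, `t = a₂`, `Q = {S ↔ a₂}`
  have hii := knLemma3i_twoCluster w a₁ a₂ b (⋃ s ∈ S, openConn s a₂) hQ₂ h12
  -- (iii) BHK Thm. 1.3: `s = a₁`, `X = {a₂}`, `Q = {S ↔ a₁}`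
  have hiii := knLemma3i_oneCluster w a₁ a₂ b (⋃ s ∈ S, openConn s a₁) hQ₁ h12
  -- (iv) BHK Thm. 1.4: `s = a₂`, `t = a₁`, `Q = {S ↔ a₁}`
  have hiv := knLemma3i_twoCluster w a₂ a₁ b (⋃ s ∈ S, openConn s a₁) hQ₁ h12.symm
  rw [hcomm] at hiv
  have hY₁ : (prodBernoulli w).real
      ((openConn a₁ a₂)ᶜ ∩ (openConn a₂ b ∩ ⋃ s ∈ S, openConn s a₁)) ≤
      (prodBernoulli w).real (openConn a₁ a₂)ᶜ :=
    measureReal_mono Set.inter_subset_left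
  have hY₂ : (prodBernoulli w).real
      ((openConn a₁ a₂)ᶜ ∩ (openConn a₁ b ∩ ⋃ s ∈ S, openConn s a₂)) ≤
      (prodBernoulli w).real (openConn a₁ a₂)ᶜ :=
    measureReal_mono Set.inter_subset_left
  exact knThm1Set_arith measureReal_nonneg measureReal_nonneg measureReal_nonneg
    measureReal_nonneg measureReal_nonneg hY₁ hY₂ hi hii hiii hiv

/-- **Kozma–Nitzan arXiv:2401.12397 Theorem 1 (§3.1, pp. 7–8; the pre-FKG inequality (3) for
two relays), for an observer SET `S`.**  For every vertex set `S`, relays `a₁, a₂` and target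
`b`, with `E = ⋃_{s ∈ S} ({s ↔ a₁} ∪ {s ↔ a₂})` ("`S ↔ {a₁, a₂}`"):
`min (μ(E ∩ {a₁ ↔ b}), μ(E ∩ {a₂ ↔ b})) ≤ μ(E ∩ ⋃_{s ∈ S} {s ↔ b})`.  KN's proof with `0 ↦ S`:
STEP 1 event algebra (`knThm1Set_step1`), STEP 2 four BHK 2006 applications
(`knThm1Set_bhk`, via the proved `knLemma3i_oneCluster` / `knLemma3i_twoCluster`), and the
degenerate case `φ₁ = φ₂ = 0` (`knThm1Set_degenerate`).
[cite: KozmaNitzan2024, Theorem 1 (§3.1, inequality (3))] -/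
theorem stub_knThm1Set :
    ∀ (n : ℕ) (w : Sym2 (Fin n) → unitInterval) (S : Finset (Fin n)) (a₁ a₂ b : Fin n),
      min ((prodBernoulli w).real
            ((⋃ s ∈ S, (openConn s a₁ ∪ openConn s a₂)) ∩ openConn a₁ b))
          ((prodBernoulli w).real
            ((⋃ s ∈ S, (openConn s a₁ ∪ openConn s a₂)) ∩ openConn a₂ b)) ≤
        (prodBernoulli w).real
          ((⋃ s ∈ S, (openConn s a₁ ∪ openConn s a₂)) ∩ (⋃ s ∈ S, openConn s b))
    := by
  intro n w S a₁ a₂ b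
  -- `E = {S ↔ a₁} ∪ {S ↔ a₂}`
  have hEeq : (⋃ s ∈ S, (openConn s a₁ ∪ openConn s a₂) : Set (BondConfig (Fin n))) =
      (⋃ s ∈ S, openConn s a₁) ∪ ⋃ s ∈ S, openConn s a₂ := by
    ext ω
    simp only [Set.mem_iUnion, Set.mem_union, exists_prop]
    constructor
    · rintro ⟨s, hs, h | h⟩
      exacts [Or.inl ⟨s, hs, h⟩, Or.inr ⟨s, hs, h⟩]
    · rintro (⟨s, hs, h⟩ | ⟨s, hs, h⟩)
      exacts [⟨s, hs, Or.inl h⟩, ⟨s, hs, Or.inr h⟩]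
  set E := (⋃ s ∈ S, (openConn s a₁ ∪ openConn s a₂) : Set (BondConfig (Fin n))) with hEdef
  have hE : E ⊆ (⋃ s ∈ S, openConn s a₁) ∪ ⋃ s ∈ S, openConn s a₂ := hEeq.le
  have hE' : E ⊆ (⋃ s ∈ S, openConn s a₂) ∪ ⋃ s ∈ S, openConn s a₁ :=
    hEeq.le.trans (Set.union_comm _ _).le
  have hE₁ : (⋃ s ∈ S, openConn s a₁ : Set (BondConfig (Fin n))) ⊆ E := by
    rw [hEeq]; exact Set.subset_union_left
  have hE₂ : (⋃ s ∈ S, openConn s a₂ : Set (BondConfig (Fin n))) ⊆ E := by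
    rw [hEeq]; exact Set.subset_union_right
  have hφ₁0 : 0 ≤ (prodBernoulli w).real ((openConn a₁ a₂)ᶜ ∩ ⋃ s ∈ S, openConn s a₁) :=
    measureReal_nonneg
  have hφ₂0 : 0 ≤ (prodBernoulli w).real ((openConn a₁ a₂)ᶜ ∩ ⋃ s ∈ S, openConn s a₂) :=
    measureReal_nonneg
  rcases eq_or_lt_of_le (add_nonneg hφ₁0 hφ₂0) with h0 | hpos
  · -- degenerate case `φ₁ = φ₂ = 0` (covers `a₁ = a₂`)
    have h1 : (prodBernoulli w).real ((openConn a₁ a₂)ᶜ ∩ ⋃ s ∈ S, openConn s a₁) = 0 := by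
      linarith
    have h2 : (prodBernoulli w).real ((openConn a₁ a₂)ᶜ ∩ ⋃ s ∈ S, openConn s a₂) = 0 := by
      linarith
    exact min_le_of_left_le (knThm1Set_degenerate w S a₁ a₂ b E hE h1 h2)
  · have h12 : a₁ ≠ a₂ := by
      intro h
      have hD : ((openConn a₁ a₂)ᶜ : Set (BondConfig (Fin n))) = ∅ :=
        Set.compl_empty_iff.2 (Set.eq_univ_of_forall fun ω =>
          show (openGraph ω).Reachable a₁ a₂ from h ▸ SimpleGraph.Reachable.refl a₁)
      rw [hD, Set.empty_inter, Set.empty_inter, measureReal_empty, add_zero] at hpos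
      exact lt_irrefl _ hpos
    have hcomm : (openConn a₂ a₁ : Set (BondConfig (Fin n))) = openConn a₁ a₂ :=
      Set.ext fun _ => ⟨fun h => SimpleGraph.Reachable.symm h,
        fun h => SimpleGraph.Reachable.symm h⟩
    -- STEP 1, for `a₁` and (symmetrically) for `a₂`
    have hs1 := knThm1Set_step1 w S a₁ a₂ b E hE₂ hE
    have hs2 := knThm1Set_step1 w S a₂ a₁ b E hE₁ hE'
    rw [hcomm] at hs2
    -- STEP 2
    have hL := knThm1Set_bhk w S a₁ a₂ b h12
    have hk1 := mul_le_mul_of_nonneg_left hs1 hφ₁0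
    have hk2 := mul_le_mul_of_nonneg_left hs2 hφ₂0
    have hmin1 := min_le_left ((prodBernoulli w).real (E ∩ openConn a₁ b))
      ((prodBernoulli w).real (E ∩ openConn a₂ b))
    have hmin2 := min_le_right ((prodBernoulli w).real (E ∩ openConn a₁ b))
      ((prodBernoulli w).real (E ∩ openConn a₂ b))
    have hm1 := mul_le_mul_of_nonneg_left hmin1 hφ₁0
    have hm2 := mul_le_mul_of_nonneg_left hmin2 hφ₂0
    refine le_of_mul_le_mul_left ?_ hpos
    linarith [hk1, hk2, hL, hm1, hm2]

end

end Summit.CriticalPhenomena.PercolationContinuityZ3.Theorems
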